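import Summits.Langlands.Langlands.Theses.ExteriorSquareAscent
import Literature.NumberTheory.GaloisRepresentations.WeakAbelianDirectSummand

/-!
# Stub `stub_planesAmbient` of line `Sketch` for crux stmt-Langlands-18054
(`Summit.Langlands.Langlands.Theses.ExteriorSquareAscent.ReducibleInducesSquare`)

The (2,2) case of the line: `ρ : Γ_K → GL₄(ℚ̄_ℓ)` is in block form,
`charpoly ρ(g) = charpoly S(g) · charpoly T(g)` with `S, T : Γ_K →ₜ* GL₂(ℚ̄_ℓ)`, `ker ρ ≤ ker S ∩ ker T`,
and `ρ` is unramified almost everywhere.  We build the character `ψ = det ∘ S : Γ_K →ₜ* GL₁` and the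
AMBIENT continuous representation `ρ' = det S ⊕ det T ⊕ (S ⊗ T) : Γ_K →ₜ* GL₆(ℚ̄_ℓ)` (block diagonal,
`Matrix.fromBlocks`, Kronecker product `Matrix.kroneckerMap`, reindexed to `Fin 6`), and prove:

* `ψ(g)₀₀ = det S(g)`;
* `ψ` weakly divides `ρ'` (`FramedGaloisRep.WeaklyDivides.of_eventually`): wherever `ρ` is
  unramified so are `ψ` and `ρ'` (`ρ(σ) = 1 ⇒ S(σ) = T(σ) = 1 ⇒ ψ(σ) = 1, ρ'(σ) = 1`), and
  `charpoly ψ(σ) = X - det S(σ)` is the first factor of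
  `charpoly ρ'(σ) = (X - det S(σ)) (X - det T(σ)) charpoly(S(σ) ⊗ T(σ))`
  (`Matrix.charpoly_reindex`, `Matrix.charpoly_fromBlocks_zero₁₂`);
* `ρ'` is `E`-rational whenever `ρ` is: with `charpoly S(σ) = X² - aX + b`,
  `charpoly T(σ) = X² - cX + d` (`Matrix.charpoly_fin_two`) one has
  `charpoly (S(σ) ⊗ T(σ)) = X⁴ - ac X³ + (a²d + c²b - 2bd) X² - abcd X + b²d²` (a `4 × 4`
  determinant, `charpoly_kronecker_fin_two`), so `charpoly ρ'(σ)` is the sextic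
  `X⁶ - e₂X⁵ + (e₁e₃ - e₄)X⁴ - (e₃² + e₁²e₄ - 2e₂e₄)X³ + e₄(e₁e₃ - e₄)X² - e₂e₄²X + e₄³` in the
  coefficients `e₁ = a + c, e₂ = b + d + ac, e₃ = ad + bc, e₄ = bd` of
  `charpoly ρ(σ) = X⁴ - e₁X³ + e₂X² - e₃X + e₄ ∈ e(E[X])` (`exists_map_eq_sextic`).
-/

set_option linter.dupNamespace false -- `Summit.Langlands.Langlands` is the mandated namespace

noncomputable section

namespace Summit.Langlands.Langlands.Cruxes.ReducibleInducesSquare.Sketch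

open Literature.NumberTheory.GaloisRepresentations
open Polynomial
open scoped Kronecker MatrixGroups

/-! ### `4 × 4` determinants and the characteristic polynomial of a Kronecker product -/

section FourByFour

variable {R : Type*} [CommRing R]

/-- Laplace expansion of a `4 × 4` determinant along the first row
(`Matrix.det_succ_row_zero`, `Matrix.det_fin_three`). [folklore] -/
theorem det_fin_four (N : Matrix (Fin 4) (Fin 4) R) :
    N.det =
      N 0 0 * (N 1 1 * N 2 2 * N 3 3 - N 1 1 * N 2 3 * N 3 2 - N 1 2 * N 2 1 * N 3 3
        + N 1 2 * N 2 3 * N 3 1 + N 1 3 * N 2 1 * N 3 2 - N 1 3 * N 2 2 * N 3 1)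
      - N 0 1 * (N 1 0 * N 2 2 * N 3 3 - N 1 0 * N 2 3 * N 3 2 - N 1 2 * N 2 0 * N 3 3
        + N 1 2 * N 2 3 * N 3 0 + N 1 3 * N 2 0 * N 3 2 - N 1 3 * N 2 2 * N 3 0)
      + N 0 2 * (N 1 0 * N 2 1 * N 3 3 - N 1 0 * N 2 3 * N 3 1 - N 1 1 * N 2 0 * N 3 3
        + N 1 1 * N 2 3 * N 3 0 + N 1 3 * N 2 0 * N 3 1 - N 1 3 * N 2 1 * N 3 0)
      - N 0 3 * (N 1 0 * N 2 1 * N 3 2 - N 1 0 * N 2 2 * N 3 1 - N 1 1 * N 2 0 * N 3 2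
        + N 1 1 * N 2 2 * N 3 0 + N 1 2 * N 2 0 * N 3 1 - N 1 2 * N 2 1 * N 3 0) := by
  -- adapted from Literature.Barriers.Langlands.TwistedEndoscopySelfDual `det_fin_four`
  rw [Matrix.det_succ_row_zero]
  simp [Fin.sum_univ_succ, Matrix.det_fin_three, Matrix.submatrix_apply, Fin.succAbove]
  ring

/-- The Kronecker product of two `2 × 2` matrices, reindexed to `Fin 4` (`finProdFinEquiv`,
lexicographic), entrywise. [folklore] -/
theorem reindex_kronecker_fin_two (a c : Matrix (Fin 2) (Fin 2) R) :
    Matrix.reindex finProdFinEquiv finProdFinEquiv (a ⊗ₖ c) =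
      !![a 0 0 * c 0 0, a 0 0 * c 0 1, a 0 1 * c 0 0, a 0 1 * c 0 1;
         a 0 0 * c 1 0, a 0 0 * c 1 1, a 0 1 * c 1 0, a 0 1 * c 1 1;
         a 1 0 * c 0 0, a 1 0 * c 0 1, a 1 1 * c 0 0, a 1 1 * c 0 1;
         a 1 0 * c 1 0, a 1 0 * c 1 1, a 1 1 * c 1 0, a 1 1 * c 1 1] := by
  ext i j
  fin_cases i <;> fin_cases j <;> rfl

/-- The characteristic matrix `X·1 - N` of a `4 × 4` matrix, entrywise
(`Matrix.charmatrix_apply_eq`, `Matrix.charmatrix_apply_ne`). [folklore] -/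
theorem charmatrix_fin_four (N : Matrix (Fin 4) (Fin 4) R) :
    N.charmatrix = !![X - C (N 0 0), -C (N 0 1), -C (N 0 2), -C (N 0 3);
                      -C (N 1 0), X - C (N 1 1), -C (N 1 2), -C (N 1 3);
                      -C (N 2 0), -C (N 2 1), X - C (N 2 2), -C (N 2 3);
                      -C (N 3 0), -C (N 3 1), -C (N 3 2), X - C (N 3 3)] := by
  ext i j
  fin_cases i <;> fin_cases j <;> simp

/-- **Characteristic polynomial of the Kronecker product of two `2 × 2` matrices** over a
commutative ring, in terms of traces and determinants: with `charpoly a = X² - t_a X + d_a`,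
`charpoly c = X² - t_c X + d_c`,
`charpoly (a ⊗ c) = X⁴ - t_a t_c X³ + (t_a² d_c + t_c² d_a - 2 d_a d_c) X² - t_a d_a t_c d_c X + d_a² d_c²`
(a polynomial identity in the eight entries: `Matrix.charpoly_reindex` to `Fin 4`, `det_fin_four`,
`ring`). [folklore] -/
theorem charpoly_kronecker_fin_two (a c : Matrix (Fin 2) (Fin 2) R) :
    (a ⊗ₖ c).charpoly =
      X ^ 4 - C (a.trace * c.trace) * X ^ 3
        + C (a.trace ^ 2 * c.det + c.trace ^ 2 * a.det - 2 * a.det * c.det) * X ^ 2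
        - C (a.trace * a.det * c.trace * c.det) * X + C (a.det ^ 2 * c.det ^ 2) := by
  rw [← Matrix.charpoly_reindex finProdFinEquiv, reindex_kronecker_fin_two, Matrix.charpoly,
    charmatrix_fin_four, det_fin_four]
  simp only [Matrix.of_apply, Matrix.cons_val_zero, Matrix.cons_val_one, Matrix.cons_val,
    Matrix.trace_fin_two, Matrix.det_fin_two, map_add, map_sub, map_mul, map_pow, map_ofNat]
  ring

/-- The characteristic polynomial of the `1 × 1` matrix `(d)` is `X - d`
(`Matrix.det_fin_one`). [folklore] -/
theorem charpoly_smul_one_fin_one (d : R) :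
    (d • (1 : Matrix (Fin 1) (Fin 1) R)).charpoly = X - C d := by
  rw [Matrix.charpoly, Matrix.det_fin_one, Matrix.charmatrix_apply_eq]
  simp

end FourByFour

/-! ### The sextic `det a ⊕ det c ⊕ (a ⊗ c)` has coefficients in those of `charpoly a · charpoly c` -/

section Sextic

variable {E B : Type*} [CommRing E] [CommRing B]

/-- The coefficients of the monic quartic `X⁴ - e₁X³ + e₂X² - e₃X + e₄`. [folklore] -/
theorem coeff_quartic (e₁ e₂ e₃ e₄ : B) :
    (X ^ 4 - C e₁ * X ^ 3 + C e₂ * X ^ 2 - C e₃ * X + C e₄ : B[X]).coeff 3 = -e₁ ∧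
    (X ^ 4 - C e₁ * X ^ 3 + C e₂ * X ^ 2 - C e₃ * X + C e₄ : B[X]).coeff 2 = e₂ ∧
    (X ^ 4 - C e₁ * X ^ 3 + C e₂ * X ^ 2 - C e₃ * X + C e₄ : B[X]).coeff 1 = -e₃ ∧
    (X ^ 4 - C e₁ * X ^ 3 + C e₂ * X ^ 2 - C e₃ * X + C e₄ : B[X]).coeff 0 = e₄ := by
  simp [coeff_X_pow, coeff_C, coeff_X]

/-- **The `∧²`-type sextic resolvent has coefficients in the coefficient ring of the quartic.**
If `P ∈ E[X]` maps under `e : E →+* B` to `(X² - t_a X + d_a)(X² - t_c X + d_c)`, then the sextic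
`(X - d_a)(X - d_c) · charpoly(a ⊗ c)` (see `charpoly_kronecker_fin_two`) is the image of an
explicit `P' ∈ E[X]` whose coefficients are polynomials in those of `P`: with
`P = X⁴ - e₁X³ + e₂X² - e₃X + e₄`,
`P' = X⁶ - e₂X⁵ + (e₁e₃ - e₄)X⁴ - (e₃² + e₁²e₄ - 2e₂e₄)X³ + e₄(e₁e₃ - e₄)X² - e₂e₄²X + e₄³`
(`Polynomial.coeff_map` and `ring`). [folklore] -/
theorem exists_map_eq_sextic (e : E →+* B) (P : E[X]) :
    ∃ P' : E[X], ∀ ta da tc dc : B,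
      P.map e = (X ^ 2 - C ta * X + C da) * (X ^ 2 - C tc * X + C dc) →
      P'.map e = (X - C da) * (X - C dc) *
        (X ^ 4 - C (ta * tc) * X ^ 3 + C (ta ^ 2 * dc + tc ^ 2 * da - 2 * da * dc) * X ^ 2
          - C (ta * da * tc * dc) * X + C (da ^ 2 * dc ^ 2)) := by
  refine ⟨X ^ 6 - C (P.coeff 2) * X ^ 5 + C (P.coeff 3 * P.coeff 1 - P.coeff 0) * X ^ 4
      - C (P.coeff 1 ^ 2 + P.coeff 3 ^ 2 * P.coeff 0 - 2 * P.coeff 2 * P.coeff 0) * X ^ 3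
      + C (P.coeff 0 * (P.coeff 3 * P.coeff 1 - P.coeff 0)) * X ^ 2
      - C (P.coeff 2 * P.coeff 0 ^ 2) * X + C (P.coeff 0 ^ 3), fun ta da tc dc hP => ?_⟩
  have hq : P.map e = X ^ 4 - C (ta + tc) * X ^ 3 + C (da + dc + ta * tc) * X ^ 2
      - C (ta * dc + da * tc) * X + C (da * dc) := by
    rw [hP]
    simp only [map_add, map_mul]
    ring
  obtain ⟨c3, c2, c1, c0⟩ := coeff_quartic (B := B) (ta + tc) (da + dc + ta * tc)
    (ta * dc + da * tc) (da * dc)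
  have h3 : e (P.coeff 3) = -(ta + tc) := by rw [← coeff_map, hq]; exact c3
  have h2 : e (P.coeff 2) = da + dc + ta * tc := by rw [← coeff_map, hq]; exact c2
  have h1 : e (P.coeff 1) = -(ta * dc + da * tc) := by rw [← coeff_map, hq]; exact c1
  have h0 : e (P.coeff 0) = da * dc := by rw [← coeff_map, hq]; exact c0
  simp only [Polynomial.map_add, Polynomial.map_sub, Polynomial.map_mul, Polynomial.map_pow,
    Polynomial.map_X, Polynomial.map_C]
  simp only [map_add, map_sub, map_mul, map_pow, map_neg, map_ofNat, h0, h1, h2, h3]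
  ring

end Sextic

/-! ### Block-diagonal and Kronecker constructions of framed continuous representations -/

section Framed

variable {G : Type*} [Group G] [TopologicalSpace G] {A : Type*} [CommRing A] [TopologicalSpace A]

/-- **A framed continuous representation from a continuous multiplicative matrix construction.**
If `F(a, c)` is a matrix depending continuously on `(a, c)` with `F(1, 1) = 1` and
`F(ab, cd) = F(a, c) F(b, d)`, then for framed continuous representations `S, T` of `G`,
`g ↦ F(S(g), T(g))` is a framed continuous representation: it is a monoid homomorphism, hence
lands in units (`MonoidHom.toHomUnits`, inverse `F(S(g⁻¹), T(g⁻¹))`), and it and its inverse are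
continuous (`Units.continuous_iff`, `Units.continuous_val`, `Units.continuous_coe_inv`).
[folklore] -/
theorem exists_framedRep_of_map₂ {m n k : ℕ} (S : FramedRep G A m) (T : FramedRep G A n)
    (F : Matrix (Fin m) (Fin m) A → Matrix (Fin n) (Fin n) A → Matrix (Fin k) (Fin k) A)
    (h1 : F 1 1 = 1) (hmul : ∀ a b c d, F (a * b) (c * d) = F a c * F b d)
    (hc : Continuous fun p : Matrix (Fin m) (Fin m) A × Matrix (Fin n) (Fin n) A => F p.1 p.2) :
    ∃ ρ' : FramedRep G A k, ∀ g : G,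
      ((ρ' g : GL (Fin k) A) : Matrix (Fin k) (Fin k) A) =
        F ((S g : GL (Fin m) A) : Matrix (Fin m) (Fin m) A)
          ((T g : GL (Fin n) A) : Matrix (Fin n) (Fin n) A) := by
  obtain ⟨M, hM⟩ : ∃ M : G →* Matrix (Fin k) (Fin k) A, ∀ g : G,
      M g = F ((S g : GL (Fin m) A) : Matrix (Fin m) (Fin m) A)
        ((T g : GL (Fin n) A) : Matrix (Fin n) (Fin n) A) :=
    ⟨{ toFun := fun g => F ((S g : GL (Fin m) A) : Matrix (Fin m) (Fin m) A)
          ((T g : GL (Fin n) A) : Matrix (Fin n) (Fin n) A)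
       map_one' := by simp only [map_one, Units.val_one, h1]
       map_mul' := fun g h => by simp only [map_mul, Units.val_mul, hmul] }, fun g => rfl⟩
  have hval : Continuous fun g => M g := by
    simp only [hM]
    exact hc.comp ((Units.continuous_val.comp (map_continuous S)).prodMk
      (Units.continuous_val.comp (map_continuous T)))
  have hinv : Continuous fun g => M g⁻¹ := by
    simp only [hM, map_inv]
    exact hc.comp ((Units.continuous_coe_inv.comp (map_continuous S)).prodMk
      (Units.continuous_coe_inv.comp (map_continuous T)))
  refine ⟨⟨M.toHomUnits, Units.continuous_iff.2 ⟨hval, ?_⟩⟩, fun g => hM g⟩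
  show Continuous fun g =>
    (((M.toHomUnits g)⁻¹ : (Matrix (Fin k) (Fin k) A)ˣ) : Matrix (Fin k) (Fin k) A)
  simp only [← map_inv, MonoidHom.coe_toHomUnits]
  exact hinv

variable [IsTopologicalRing A]

/-- **The block map `(a, c) ↦ diag(det a, det c, a ⊗ c) ∈ M₆`.**  There is a continuous map
`F : M₂(A) × M₂(A) → M₆(A)` with `F(1, 1) = 1`, `F(ab, cd) = F(a, c) F(b, d)` and
`charpoly F(a, c) = (X - det a)(X - det c) · charpoly(a ⊗ c)`: the block-diagonal matrix
`Matrix.fromBlocks` of the `1 × 1` blocks `det a`, `det c` and the Kronecker product `a ⊗ₖ c`,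
reindexed along `(Fin 1 ⊕ Fin 1) ⊕ (Fin 2 × Fin 2) ≃ Fin 6` (`Matrix.reindexAlgEquiv`;
`Matrix.fromBlocks_multiply`, `Matrix.mul_kronecker_mul`, `Matrix.det_mul`;
`Matrix.charpoly_reindex`, `Matrix.charpoly_fromBlocks_zero₁₂`). [folklore] -/
theorem exists_blockMap :
    ∃ F : Matrix (Fin 2) (Fin 2) A → Matrix (Fin 2) (Fin 2) A → Matrix (Fin 6) (Fin 6) A,
      F 1 1 = 1 ∧ (∀ a b c d, F (a * b) (c * d) = F a c * F b d) ∧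
      (Continuous fun p : Matrix (Fin 2) (Fin 2) A × Matrix (Fin 2) (Fin 2) A => F p.1 p.2) ∧
      ∀ a c, (F a c).charpoly = (X - C a.det) * (X - C c.det) * (a ⊗ₖ c).charpoly := by
  have e6 : (Fin 1 ⊕ Fin 1) ⊕ (Fin 2 × Fin 2) ≃ Fin 6 :=
    (Equiv.sumCongr finSumFinEquiv finProdFinEquiv).trans finSumFinEquiv
  refine ⟨fun a c => Matrix.reindexAlgEquiv A A e6
      (Matrix.fromBlocks (Matrix.fromBlocks (a.det • (1 : Matrix (Fin 1) (Fin 1) A)) 0 0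
        (c.det • (1 : Matrix (Fin 1) (Fin 1) A))) 0 0 (a ⊗ₖ c)), ?_, ?_, ?_, ?_⟩
  · simp only [Matrix.det_one, one_smul, Matrix.fromBlocks_one, Matrix.one_kronecker_one, map_one]
  · intro a b c d
    rw [← map_mul]
    simp only [Matrix.fromBlocks_multiply, Matrix.mul_zero, Matrix.zero_mul, add_zero, zero_add,
      Matrix.smul_mul, Matrix.one_mul, smul_smul, Matrix.det_mul, Matrix.mul_kronecker_mul]
  · simp only [Matrix.coe_reindexAlgEquiv]
    refine Continuous.matrix_reindex ?_ e6 e6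
    refine Continuous.matrix_fromBlocks (Continuous.matrix_fromBlocks ?_ continuous_const
      continuous_const ?_) continuous_const continuous_const ?_
    · exact (continuous_fst.matrix_det).smul continuous_const
    · exact (continuous_snd.matrix_det).smul continuous_const
    · exact continuous_matrix fun i j =>
        (continuous_fst.matrix_elem i.1 j.1).mul (continuous_snd.matrix_elem i.2 j.2)
  · intro a c
    dsimp only
    rw [Matrix.coe_reindexAlgEquiv, Matrix.charpoly_reindex, Matrix.charpoly_fromBlocks_zero₁₂,
      Matrix.charpoly_fromBlocks_zero₁₂, charpoly_smul_one_fin_one, charpoly_smul_one_fin_one]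

/-- **The ambient pair `(det S, det S ⊕ det T ⊕ (S ⊗ T))`.**  For framed continuous
representations `S, T : G →ₜ* GL₂(A)` there are framed continuous representations
`ψ : G →ₜ* GL₁(A)` and `ρ' : G →ₜ* GL₆(A)` with `ψ(g)₀₀ = det S(g)`, `ψ(g) = 1` if `S(g) = 1`,
`ρ'(g) = 1` if `S(g) = T(g) = 1`, `charpoly ψ(g) = X - det S(g)` and
`charpoly ρ'(g) = (X - det S(g))(X - det T(g)) · charpoly(S(g) ⊗ T(g))`
(`exists_framedRep_of_map₂`, `exists_blockMap`). [folklore] -/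
theorem exists_ambient (S T : FramedRep G A 2) :
    ∃ (ψ : FramedRep G A 1) (ρ' : FramedRep G A 6),
      (∀ g : G, ((ψ g : GL (Fin 1) A) : Matrix (Fin 1) (Fin 1) A) 0 0 =
          ((S g : GL (Fin 2) A) : Matrix (Fin 2) (Fin 2) A).det) ∧
      (∀ g : G, S g = 1 → ψ g = 1) ∧
      (∀ g : G, S g = 1 → T g = 1 → ρ' g = 1) ∧
      (∀ g : G, FramedRep.charpoly ψ g =
          X - C ((S g : GL (Fin 2) A) : Matrix (Fin 2) (Fin 2) A).det) ∧
      (∀ g : G, FramedRep.charpoly ρ' g =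
          (X - C ((S g : GL (Fin 2) A) : Matrix (Fin 2) (Fin 2) A).det) *
            (X - C ((T g : GL (Fin 2) A) : Matrix (Fin 2) (Fin 2) A).det) *
            (((S g : GL (Fin 2) A) : Matrix (Fin 2) (Fin 2) A) ⊗ₖ
              ((T g : GL (Fin 2) A) : Matrix (Fin 2) (Fin 2) A)).charpoly) := by
  obtain ⟨F, hF1, hFmul, hFc, hFchar⟩ := exists_blockMap (A := A)
  obtain ⟨ρ', hρ'⟩ := exists_framedRep_of_map₂ S T F hF1 hFmul hFc
  obtain ⟨ψ, hψ⟩ := exists_framedRep_of_map₂ S T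
    (fun a _ => a.det • (1 : Matrix (Fin 1) (Fin 1) A))
    (by simp only [Matrix.det_one, one_smul])
    (fun a b c d => by simp only [Matrix.det_mul, Matrix.smul_mul, Matrix.one_mul, smul_smul])
    ((continuous_fst.matrix_det).smul continuous_const)
  refine ⟨ψ, ρ', fun g => ?_, fun g hg => ?_, fun g hS hT => ?_, fun g => ?_, fun g => ?_⟩
  · rw [hψ]
    simp
  · refine Units.ext ?_
    rw [hψ, hg, Units.val_one, Matrix.det_one, one_smul, Units.val_one]
  · refine Units.ext ?_
    rw [hρ', hS, hT, Units.val_one, Units.val_one, hF1]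
  · rw [FramedRep.charpoly, hψ, charpoly_smul_one_fin_one]
  · rw [FramedRep.charpoly, hρ', hFchar]

end Framed

/-! ### The stub -/

/-- **STUB C — the ambient representation of the (2,2) shape.**  For `ρ : Γ_K → GL₄(ℚ̄_ℓ)` with
`charpoly ρ(g) = charpoly S(g) · charpoly T(g)` (`S, T : Γ_K →ₜ* GL₂(ℚ̄_ℓ)`),
`ρ(g) = 1 ⇒ S(g) = T(g) = 1`, and `ρ` unramified almost everywhere, the character `ψ = det ∘ S`
(as a rank-one framed representation, `ψ(g)₀₀ = det S(g)`) weakly divides the continuous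
representation `ρ' = det S ⊕ det T ⊕ (S ⊗ T) : Γ_K →ₜ* GL₆(ℚ̄_ℓ)` (`exists_ambient`,
`FramedGaloisRep.WeaklyDivides.of_eventually`: both are unramified wherever `ρ` is, and
`X - det S(σ)` divides `charpoly ρ'(σ) = (X - det S(σ))(X - det T(σ)) charpoly(S(σ) ⊗ T(σ))`), and
`ρ'` is `E`-rational whenever `ρ` is: `charpoly ρ'(σ)` is the sextic resolvent
(`charpoly_kronecker_fin_two`, `exists_map_eq_sextic`) of `charpoly ρ(σ) ∈ e(E[X])`
(`Matrix.charpoly_fin_two`). [folklore] -/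
theorem stub_planesAmbient :
    ∀ (K : Type) [Field K] [NumberField K] (ℓ : ℕ) [Fact ℓ.Prime]
      (ρ : Literature.NumberTheory.GaloisRepresentations.FramedGaloisRep K (PadicAlgCl ℓ) 4)
      (S T : Literature.NumberTheory.GaloisRepresentations.FramedGaloisRep K (PadicAlgCl ℓ) 2),
      (∀ g : Field.absoluteGaloisGroup K,
        Literature.NumberTheory.GaloisRepresentations.FramedRep.charpoly ρ g =
          Literature.NumberTheory.GaloisRepresentations.FramedRep.charpoly S g *
            Literature.NumberTheory.GaloisRepresentations.FramedRep.charpoly T g) →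
      (∀ g : Field.absoluteGaloisGroup K, ρ g = 1 → S g = 1 ∧ T g = 1) →
      (∀ᶠ v : IsDedekindDomain.HeightOneSpectrum (NumberField.RingOfIntegers K) in Filter.cofinite,
        ρ.IsUnramifiedAt v) →
      ∃ (ψ : Literature.NumberTheory.GaloisRepresentations.FramedGaloisRep K (PadicAlgCl ℓ) 1)
        (ρ' : Literature.NumberTheory.GaloisRepresentations.FramedGaloisRep K (PadicAlgCl ℓ) 6),
        (∀ g : Field.absoluteGaloisGroup K,
          ((ψ g : Matrix.GeneralLinearGroup (Fin 1) (PadicAlgCl ℓ)) :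
              Matrix (Fin 1) (Fin 1) (PadicAlgCl ℓ)) 0 0 =
            ((S g : Matrix.GeneralLinearGroup (Fin 2) (PadicAlgCl ℓ)) :
              Matrix (Fin 2) (Fin 2) (PadicAlgCl ℓ)).det) ∧
        ψ.WeaklyDivides ρ' ∧
        ∀ (E : Type) [Field E] [NumberField E] (e : E →+* PadicAlgCl ℓ),
          ρ.IsRationalOver e → ρ'.IsRationalOver e := by
  intro K _ _ ℓ _ ρ S T hchar hker hunr
  obtain ⟨ψ, ρ', hψ00, hψ1, hρ'1, hψchar, hρ'char⟩ := exists_ambient S T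
  -- wherever `ρ` is unramified, so are `ρ'` and `ψ`
  have hunr' : ∀ v : IsDedekindDomain.HeightOneSpectrum (NumberField.RingOfIntegers K),
      ρ.IsUnramifiedAt v →
        FramedGaloisRep.IsUnramifiedAt v ρ' ∧ FramedGaloisRep.IsUnramifiedAt v ψ := fun v hv =>
    ⟨fun 𝔓 h𝔓 σ hσ => hρ'1 σ (hker σ (hv 𝔓 h𝔓 σ hσ)).1 (hker σ (hv 𝔓 h𝔓 σ hσ)).2,
      fun 𝔓 h𝔓 σ hσ => hψ1 σ (hker σ (hv 𝔓 h𝔓 σ hσ)).1⟩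
  refine ⟨ψ, ρ', hψ00, ?_, ?_⟩
  · refine FramedGaloisRep.WeaklyDivides.of_eventually (hunr.mono fun v hv => ?_)
    refine ⟨(hunr' v hv).1, (hunr' v hv).2, fun 𝔓 h𝔓 σ hσ => ?_⟩
    rw [hψchar, hρ'char, mul_assoc]
    exact dvd_mul_right _ _
  · intro E _ _ e hρE
    refine hρE.mono fun v hv => ⟨(hunr' v hv.1).1, ?_⟩
    obtain ⟨P, hP⟩ := hv.2
    obtain ⟨P', hP'⟩ := exists_map_eq_sextic e P
    refine ⟨P', fun 𝔓 h𝔓 σ hσ => ?_⟩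
    rw [hρ'char σ, charpoly_kronecker_fin_two]
    refine (hP' _ _ _ _ ?_).symm
    rw [← hP 𝔓 h𝔓 σ hσ, hchar σ, FramedRep.charpoly, FramedRep.charpoly, Matrix.charpoly_fin_two,
      Matrix.charpoly_fin_two]

end Summit.Langlands.Langlands.Cruxes.ReducibleInducesSquare.Sketch

end
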